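import Summits.QuantumFields.YangMills.Theses.FlatTubeReduction
import Summits.QuantumFields.YangMills.Theorems.FemtoCutoffLadderThinningDefs
import Literature.MathematicalPhysics.QuantumFieldTheory.TorusConfigShift
import HarnessLib

/-!
# Route `FlatTubeReduction` — DEFINITIONS for crux `PinnedUnitStepEx` (stmt-QuantumFields-27561), registered skeleton «ti-split-1»

Seat ym-line-fcl-p3 g9 (2026-08-28).  The two stub Props of the planner's (ym-idea-1 g6) registered skeleton «ti-split-1» of crux
`PinnedUnitStepEx` (`HOME/PUnitEx_tisplit1.lean`, `ledger skeleton check` on the item), VERBATIM and under the skeleton's own namespace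
`Summit.QuantumFields.YangMills.Cruxes.PinnedUnitStepEx.TISplit1`, so that the Theorems files which land the stubs
(`theorem stub_smearVarPosGS1 : SmearVarPosGS1`, `theorem stub_pinnedAutocorrExTI1 : PinnedAutocorrExTI1`) can import them — the pattern of
`FemtoCutoffLadderTraceDefs.lean` for crux `OctaveStepDecay`:

* `SmearVarPosGS1` — W-inj at `m = L − L′ = 1` against the coarse ground state (stub 1, kinematic);
* `PinnedAutocorrExTI1` — the one-slab pinned autocorrelation comparison with a translation-invariant chosen coarse eigenfunction (stub 2, XL);
* `WInjUnit` — the NAMED-KINEMATICS core of stub 1 (memo `WINJ-m1-proof-fcl-p3-g9.md`, evidence on the item, Theorem W(1)): for every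
  `L′ ≥ 1` and every bounded measurable gauge-invariant coarse-translation-invariant `g` on `GaugeConfig 3 L′ SU2` that is NOT a.e. constant,
  the fine-translation SUM of its thinning pull-backs `U ↦ Σ_v g(thin L′ (τ_v U))` on `GaugeConfig 3 (L′+1) SU2` is not a.e. constant.
  The door `smearVarPosGS1_of_wInjUnit : WInjUnit → SmearVarPosGS1` (sibling Theorems file) reduces stub 1 to exactly this statement
  (ground-state translation invariance `GroundStateUnique.groundState_translationInvariant`, strict Cauchy–Schwarz, inline ↔ named bridges).
Definitions only; R2b1 is a RECORD rung; nothing here proves any stub, crux or summit.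
-/

set_option autoImplicit false

namespace Summit.QuantumFields.YangMills.Cruxes.PinnedUnitStepEx.TISplit1

open MeasureTheory
open Summit.QuantumFields.YangMills.Theses.FlatTubeReduction
open Summit.QuantumFields.YangMills.Theorems.FemtoTransferGap

/-- Registered stub Prop of line «ti-split-1» on crux `PinnedUnitStepEx` (stmt-QuantumFields-27561; an OPEN kinematic claim of the route, NOT a
literature fact): W-inj at `m = 1` against the coarse ground state — the one-slab smeared trial of a translation-invariant coarse observable has
strictly positive variance. -/
def SmearVarPosGS1 : Prop :=
  open Summit.QuantumFields.YangMills.Theorems.FemtoTransferGap in ∀ (L' : ℕ) [NeZero L'] (β' : ℝ), ∀ Ω : Literature.MathematicalPhysics.QuantumFieldTheory.GaugeConfig 3 (L' + 1) SU2 → ℝ, IsPhys Ω → (∀ U, 0 < Ω U) → l2 Ω Ω = 1 → ∀ Ω' : Literature.MathematicalPhysics.QuantumFieldTheory.GaugeConfig 3 L' SU2 → ℝ, IsPhys Ω' → ∀ c' : ℝ, 0 < c' → (∀ U', c' ≤ Ω' U') → l2 Ω' Ω' = 1 → (∀ U', ∫ V', transferKernel su2Rep β' U' V' * Ω' V' ∂(configMeasure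 SU2 L') = topValue su2Rep L' β' * Ω' U') → ∀ φ' : Literature.MathematicalPhysics.QuantumFieldTheory.GaugeConfig 3 L' SU2 → ℝ, IsPhys φ' → (∀ (v' : Literature.MathematicalPhysics.QuantumFieldTheory.Site 3 L') (U' : Literature.MathematicalPhysics.QuantumFieldTheory.GaugeConfig 3 L' SU2), φ' (fun e => U' (e.1 - v', e.2)) = φ' U') → l2 φ' Ω' = 0 → l2 φ' φ' = 1 → let T : Literature.MathematicalPhysics.QuantumFieldTheory.GaugeConfig 3 (L' + 1) SU2 → Literature.MathematicalPhysics.QuantumFieldTheory.GaugeConfig 3 L' SU2 := fun U e' => (List.ofFn fun t : Fin (if (e'.1 e'.2).val < L' + 1 - L' then 2 else 1) => U ((fun j => (((e'.1 j).val + min (e'.1 j).val (L' + 1 - L') : ℕ) : ZMod (L' + 1))) + Pi.single e'.2 ((t : ℕ) : ZMod (L' + 1)), e'.2)).prod; let fbar : Literature.MathematicalPhysics.QuantumFieldTheory.GaugeConfig 3 (L' + 1) SU2 → ℝ := fun U => (Fintype.card (Literature.MathematicalPhysics.QuantumFieldTheory.Site 3 (L' + 1)) : ℝ)⁻¹ *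 ∑ v : Literature.MathematicalPhysics.QuantumFieldTheory.Site 3 (L' + 1), φ' (T fun e => U (e.1 - v, e.2)) / Ω' (T fun e => U (e.1 - v, e.2)); let ψ : Literature.MathematicalPhysics.QuantumFieldTheory.GaugeConfig 3 (L' + 1) SU2 → ℝ := fun U => fbar U * Ω U; l2 ψ Ω ^ 2 < l2 ψ ψ

/-- Registered HARD stub Prop of line «ti-split-1» on crux `PinnedUnitStepEx` (stmt-QuantumFields-27561; an OPEN crux-level claim of the route,
NOT a literature fact): the ∃φ′ (translation-invariant) one-slab pinned autocorrelation comparison with budget `e^{CΛ²/L′}`. -/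
def PinnedAutocorrExTI1 : Prop :=
  open Summit.QuantumFields.YangMills.Theorems.FemtoTransferGap in ∃ C lam0 : ℝ, 0 < lam0 ∧ ∀ lam : ℝ, 0 < lam → lam ≤ lam0 → ∃ L0 : ℕ, ∀ (L' : ℕ) [NeZero L'], L0 ≤ L' → ∀ β β' : ℝ, InFemtoWindow lam β (L' + 1) → InFemtoWindow lam β' L' → luscherLambda β (L' + 1) = luscherLambda β' L' → ∀ Ω : Literature.MathematicalPhysics.QuantumFieldTheory.GaugeConfig 3 (L' + 1) SU2 → ℝ, IsPhys Ω → (∀ U, 0 < Ω U) → l2 Ω Ω = 1 → (∀ U, ∫ V, transferKernel su2Rep β U V * Ω V ∂(configMeasure SU2 (L' + 1)) = topValue su2Rep (L' + 1) β * Ω U) → ∀ Ω' : Literature.MathematicalPhysics.QuantumFieldTheory.GaugeConfig 3 L' SU2 → ℝ, IsPhys Ω' → ∀ c' : ℝ, 0 < c' → (∀ U', c' ≤ Ω' U') → l2 Ω' Ω' = 1 → (∀ U', ∫ V', transferKernel su2Rep β' U' V' * Ω' V' ∂(configMeasure SU2 L') = topValue su2Rep L' β' * Ω' U') → ∃ φ'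 : Literature.MathematicalPhysics.QuantumFieldTheory.GaugeConfig 3 L' SU2 → ℝ, IsPhys φ' ∧ (∀ (v' : Literature.MathematicalPhysics.QuantumFieldTheory.Site 3 L') (U' : Literature.MathematicalPhysics.QuantumFieldTheory.GaugeConfig 3 L' SU2), φ' (fun e => U' (e.1 - v', e.2)) = φ' U') ∧ l2 φ' Ω' = 0 ∧ l2 φ' φ' = 1 ∧ (∀ U', ∫ V', transferKernel su2Rep β' U' V' * φ' V' ∂(configMeasure SU2 L') = secondValue su2Rep L' β' * φ' U') ∧ let T : Literature.MathematicalPhysics.QuantumFieldTheory.GaugeConfig 3 (L' + 1) SU2 → Literature.MathematicalPhysics.QuantumFieldTheory.GaugeConfig 3 L' SU2 := fun U e' => (List.ofFn fun t : Fin (if (e'.1 e'.2).val < L' + 1 - L' then 2 else 1) => U ((fun j => (((e'.1 j).val + min (e'.1 j).val (L' + 1 - L') : ℕ) : ZMod (L' + 1))) + Pi.single e'.2 ((t : ℕ) : ZMod (L' + 1)), e'.2)).prod; let fbar : Literature.MathematicalPhysics.QuantumFieldTheory.GaugeConfig 3 (L' + 1) SU2 → ℝ := fun U => (Fintype.card (Literature.MathematicalPhysics.QuantumFieldTheory.Site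 3 (L' + 1)) : ℝ)⁻¹ * ∑ v : Literature.MathematicalPhysics.QuantumFieldTheory.Site 3 (L' + 1), φ' (T fun e => U (e.1 - v, e.2)) / Ω' (T fun e => U (e.1 - v, e.2)); let ψ : Literature.MathematicalPhysics.QuantumFieldTheory.GaugeConfig 3 (L' + 1) SU2 → ℝ := fun U => fbar U * Ω U; let K : (Literature.MathematicalPhysics.QuantumFieldTheory.GaugeConfig 3 (L' + 1) SU2 → ℝ) → (Literature.MathematicalPhysics.QuantumFieldTheory.GaugeConfig 3 (L' + 1) SU2 → ℝ) := fun χ U => ∫ V, transferKernel su2Rep β U V * χ V ∂(configMeasure SU2 (L' + 1)); secondValue su2Rep L' β' ^ L' * topValue su2Rep (L' + 1) β ^ (L' + 1) * (l2 ψ ψ - l2 ψ Ω ^ 2) ≤ Real.exp (C * luscherLambda β (L' + 1) ^ 2 / (L' : ℝ)) * (topValue su2Rep L' β' ^ L' * (l2 ψ (K^[L' + 1] ψ) - topValue su2Rep (L' + 1) β ^ (L' + 1) * l2 ψ Ω ^ 2))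

/-- **W-inj at one doubled slab, named kinematics** (`thin`, `torusConfigShift`; memo Theorem W(1)): the fine-translation sum of the thinning
pull-backs of a bounded measurable, gauge-invariant, coarse-translation-invariant, NOT a.e. constant coarse observable is NOT a.e. constant on the
fine torus `(ℤ/(L′+1))³`.  (Only `gaugeInv` of `IsPhys`-type data is used; twist invariance is not needed.)  An OPEN kinematic claim of the
route (paper proof: memo on the item), NOT a literature fact. -/
def WInjUnit : Prop :=
  ∀ (L' : ℕ) [NeZero L'] (g : Literature.MathematicalPhysics.QuantumFieldTheory.GaugeConfig 3 L' SU2 → ℝ), Measurable g →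
    (∃ C : ℝ, ∀ U', |g U'| ≤ C) →
    (∀ (h : Literature.MathematicalPhysics.QuantumFieldTheory.Site 3 L' → SU2) (U' : Literature.MathematicalPhysics.QuantumFieldTheory.GaugeConfig 3 L' SU2),
      g (Literature.MathematicalPhysics.QuantumFieldTheory.gaugeTransform h U') = g U') →
    (∀ (v' : Literature.MathematicalPhysics.QuantumFieldTheory.Site 3 L') (U' : Literature.MathematicalPhysics.QuantumFieldTheory.GaugeConfig 3 L' SU2),
      g (Literature.MathematicalPhysics.QuantumFieldTheory.TorusTranslation.torusConfigShift v' U') = g U') →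
    (∀ c : ℝ, ¬ (g =ᵐ[configMeasure SU2 L'] fun _ => c)) →
    ∀ c : ℝ, ¬ ((fun U : Literature.MathematicalPhysics.QuantumFieldTheory.GaugeConfig 3 (L' + 1) SU2 =>
        ∑ v : Literature.MathematicalPhysics.QuantumFieldTheory.Site 3 (L' + 1),
          g (Summit.QuantumFields.YangMills.Theorems.FemtoCutoffLadder.Thinning.thin L'
            (Literature.MathematicalPhysics.QuantumFieldTheory.TorusTranslation.torusConfigShift v U)))
      =ᵐ[configMeasure SU2 (L' + 1)] fun _ => c)

end Summit.QuantumFields.YangMills.Cruxes.PinnedUnitStepEx.TISplit1
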